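import Summits.BirchSwinnertonDyer.BirchSwinnertonDyer.Theorems.GenusKolyvaginAtTwoK4NegPhantomTwinIffLocTrivial
import Summits.BirchSwinnertonDyer.BirchSwinnertonDyer.Theorems.GenusKolyvaginAtTwoK4NegPhantomFramePrimeFrobenius
import HarnessLib

/-!
# Route `GenusKolyvaginAtTwo`, crux K₄⁻ `K4Neg` (stmt-BirchSwinnertonDyer-31526), LINES 37/38 —
# THE `𝒩/𝒫` DICTIONARY OF THE PHANTOM CELL: `𝒫 = (β)`, `𝒩 = (α) ∪ {bit TRUE}`; the steering binder IS the twin's bit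

Width seat `bsd-line-gk2-p4` g35 (cell `bsd-f1-sign2`), WIDTH-5 attach on route `GenusKolyvaginAtTwo` rev 59; third of three files (after
`…K4NegPhantomTwinLevelFourField` — the level-`4` field of the twin — and `…K4NegPhantomTwinIffLocTrivial` — T: `𝒫(Wd) ⟺ loc_{ℓ₀} ξ_W = 0`),
composed with the trace bit of g34 (`…K4NegPhantomFrameTraceBit`, `…K4NegPhantomFramePrimeFrobenius`: at every prime Heegner frame of a `Δ < 0`
curve every Frobenius above `ℓ₀` is a transposition on `E[2]`, and `loc_{ℓ₀} ξ = 0 ⟺ 4 ∣ a_{ℓ₀}`).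
`--supports stmt-BirchSwinnertonDyer-31526 --as helper`.  THEOREMS ONLY (no definition, no named fact, no `sorry`); standard axioms.
**BSD is NOT proved by this file; `K4Neg` is NOT proved; no item is closed by it.**

SETTING: `W/ℚ` globally minimal, `Δ_W < 0`, `ρ̄_{W,2}` and `ρ_{W,4}` onto; `K` imaginary quadratic with odd `d_K = −ℓ₀` (`ℓ₀` prime), Heegner for
`N_W`, `2` split; `Wd` ANY elliptic model of `W^{(d_K)}`; `𝒩(Wd)` := «no non-zero class of `Sel₂(Wd)` dies on `Γ_{ℚ(Wd[4])}`» (the pen's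
`TwinNonPhantomBit Wd`, LINE 37 «frobenius_split»), `𝒫 := ¬𝒩`; (α)/(β) := `a_{ℓ₀}(W) ≡ 2 / 0 (mod 4)` (gk2-p3 g34 / gk2-p4 g34).

* `exists_selmer_dying_mem_torsionLocalKer_of_selmer_dying_twist` / `exists_selmer_dying_twist_of_selmer_dying_mem_torsionLocalKer` — the two
  transports in the lineage's `ℚ_{ℓ₀}` spelling; ★★★ `forall_selmer_twist_eq_zero_iff_steerAt` — **`𝒩(Wd) ⟺ SteerAt W ℓ₀`** (LINE 38's steering
  clause, body verbatim; needs `ρ̄₂` onto only).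
* ★★★ `exists_selmer_dying_twist_iff_four_dvd_frobeniusTrace` — **`𝒫(Wd) ⟺ 4 ∣ a_{ℓ₀}(W)` on the Selmer-entangled cell (`ξ_W ∈ Sel₂(W)`), at
  EVERY prime Heegner frame**; `forall_selmer_twist_eq_zero_of_not_four_dvd` ((α) ⟹ `𝒩`).
* `forall_selmer_twist_eq_zero_of_selmer_disentangled` — `𝒩(Wd)` outright when `Sel₂(W)` is disentangled (bit TRUE), whatever `a_{ℓ₀}`.
* ★★★ `forall_selmer_twist_eq_zero_iff_selmer_dying_imp_not_four_dvd` — **`𝒩(Wd) ⟺ (∀ Selmer phantom `y` of `W`, `4 ∤ a_{ℓ₀}(W)`)`**: the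
  director's (677) steering binder «`4 ∤ a_{ℓ₀}(E)` when `ξ_E ∈ Sel₂(E)`» of `K4NegSteered` / LINE 38's `SteerAt` IS the twin's bit `𝒩(Wd)`;
  hence `𝒫 = (β)` and `𝒩 = (α) ∪ {bit TRUE}` EXACTLY, and LINE 37's instrument column «tag ⟺ LOCXI0 ⟺ `a_{ℓ₀} mod 4`» is a theorem.

References: [LawsonWuthrich2016] §3, §7.1; [MazurRubin2010] Def. 3.1, Lemma 2.10–2.11, Prop. 3.3; [GrossLMS1991] §9 Prop. 9.6;
[SilvermanAEC2009] Thm. V.2.3.1.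
-/

set_option linter.dupNamespace false -- `Summit.<P>.<Sub>` repeats `BirchSwinnertonDyer` (D-0017)
set_option autoImplicit false

noncomputable section

open scoped Classical Pointwise

namespace Summit.BirchSwinnertonDyer.BirchSwinnertonDyer.Theorems.GenusExact.PhantomDescentBit.TwinLevelFour

open WeierstrassCurve Field NumberField IsDedekindDomain
open Literature.NumberTheory.GaloisRepresentations Literature.NumberTheory.EllipticCurves
open Literature.NumberTheory
open Rat.HeightOneSpectrum (primesEquiv)
open Summit.BirchSwinnertonDyer.BirchSwinnertonDyer.Theorems.GenusKolyTwistingPrime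

/-! ## §5 The `𝒩/𝒫` dictionary via the trace bit: `𝒫 = (β)`, `𝒩 = (α) ∪ {bit TRUE}` -/

section TraceDictionary

open Summit.BirchSwinnertonDyer.BirchSwinnertonDyer.Theorems.GenusKolyTwistLocal

variable (W : WeierstrassCurve ℚ) [W.IsElliptic] [W.IsGloballyMinimal] {K : Type} [Field K] [NumberField K]

/-- **TRANSPORT ⟹ in the lineage's `(2 : ℤ)` / `ℚ_{ℓ₀}` spelling**: a non-zero class of `Sel₂(Wd)` dying on `Γ_{ℚ(Wd[4])}` yields a non-zero
class of `Sel₂(W)` dying on `Γ_{ℚ(E[4])}` lying in `ker (H¹(ℚ, E[2]) → H¹(ℚ_{ℓ₀}, E[2]))`.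
[cite: MazurRubin2010, Def. 3.1, Lemma 2.10–2.11, Prop. 3.3] [cite: LawsonWuthrich2016, §3] -/
theorem exists_selmer_dying_mem_torsionLocalKer_of_selmer_dying_twist
    (hsurj : W.HasSurjectiveModNGaloisRep 2)
    (hΔ : W.Δ < 0) (hK : IsImaginaryQuadratic K) (hodd : Odd (discr K))
    (hH : SatisfiesHeegnerHypothesis (W.conductorNorm ℤ) K) (h2K : ((Ideal.span {(2 : ℤ)}).primesOver (𝓞 K)).ncard = 2)
    {ℓ : ℕ} [Fact ℓ.Prime] (hd : discr K = -(ℓ : ℤ)) {Wd : WeierstrassCurve ℚ} [Wd.IsElliptic] {C : VariableChange ℚ}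
    (hWd : C • W.quadraticTwist (discr K : ℚ) = Wd)
    {c : galH1Torsion Wd (2 : ℤ)} (hcS : c ∈ Wd.selmerGroup 2) (hc0 : c ≠ 0)
    (hcdies : ∀ h ∈ torsionFixing Wd (4 : ℤ), h1Eval Wd (2 : ℤ) c h = 0) :
    ∃ y ∈ W.selmerGroup 2, y ≠ 0 ∧ (∀ h ∈ torsionFixing W (4 : ℤ), h1Eval W (2 : ℤ) y h = 0) ∧
      y ∈ W.torsionLocalKer ℚ_[ℓ] (2 : ℤ) := by
  have hℓ : ℓ.Prime := Fact.out
  obtain ⟨v₀, hv₀⟩ : ∃ v : HeightOneSpectrum (𝓞 ℚ), ((primesEquiv v : Nat.Primes) : ℕ) = ℓ :=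
    ⟨primesEquiv.symm ⟨ℓ, hℓ⟩, by rw [Equiv.apply_symm_apply]⟩
  have hℓv₀ : (ℓ : 𝓞 ℚ) ∈ v₀.asIdeal := by
    rw [← hv₀]
    exact Rat.HeightOneSpectrum.natCast_natGenerator_mem v₀
  have e2 : (2 : ℤ) = ((2 : ℕ) : ℤ) := by norm_num
  revert c
  rw [e2]
  intro c hcS hc0 hcdies
  obtain ⟨y, hyS, hy0, hydies, hyloc⟩ :=
    exists_selmer_dying_strict_of_selmer_dying_twist_natCast W hsurj hΔ hK hodd hH h2K hd hWd hcS hc0 hcdies hℓv₀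
  refine ⟨y, hyS, hy0, hydies, ?_⟩
  subst hv₀
  exact mem_strictLocalKer_of_localization_eq_zero W v₀ hyloc

/-- **TRANSPORT ⟸ in the lineage's `(2 : ℤ)` / `ℚ_{ℓ₀}` spelling**: a non-zero class of `Sel₂(W)` dying on `Γ_{ℚ(E[4])}` and lying in
`ker (H¹(ℚ, E[2]) → H¹(ℚ_{ℓ₀}, E[2]))` is matched by a non-zero class of `Sel₂(Wd)` dying on `Γ_{ℚ(Wd[4])}`.
[cite: MazurRubin2010, Def. 3.1, Lemma 2.10, Prop. 3.3] [cite: LawsonWuthrich2016, §3] -/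
theorem exists_selmer_dying_twist_of_selmer_dying_mem_torsionLocalKer
    (hsurj : W.HasSurjectiveModNGaloisRep 2)
    (hΔ : W.Δ < 0) (hK : IsImaginaryQuadratic K)
    (hH : SatisfiesHeegnerHypothesis (W.conductorNorm ℤ) K) (h2K : ((Ideal.span {(2 : ℤ)}).primesOver (𝓞 K)).ncard = 2)
    {ℓ : ℕ} [Fact ℓ.Prime] (hd : discr K = -(ℓ : ℤ)) {Wd : WeierstrassCurve ℚ} [Wd.IsElliptic] {C : VariableChange ℚ}
    (hWd : C • W.quadraticTwist (discr K : ℚ) = Wd)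
    {x : galH1Torsion W (2 : ℤ)} (hxS : x ∈ W.selmerGroup 2) (hx0 : x ≠ 0)
    (hx : ∀ h ∈ torsionFixing W (4 : ℤ), h1Eval W (2 : ℤ) x h = 0) (hloc : x ∈ W.torsionLocalKer ℚ_[ℓ] (2 : ℤ)) :
    ∃ c ∈ Wd.selmerGroup 2, c ≠ 0 ∧ ∀ h ∈ torsionFixing Wd (4 : ℤ), h1Eval Wd (2 : ℤ) c h = 0 := by
  have hℓ : ℓ.Prime := Fact.out
  obtain ⟨v₀, hv₀⟩ : ∃ v : HeightOneSpectrum (𝓞 ℚ), ((primesEquiv v : Nat.Primes) : ℕ) = ℓ :=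
    ⟨primesEquiv.symm ⟨ℓ, hℓ⟩, by rw [Equiv.apply_symm_apply]⟩
  have hℓv₀ : (ℓ : 𝓞 ℚ) ∈ v₀.asIdeal := by
    rw [← hv₀]
    exact Rat.HeightOneSpectrum.natCast_natGenerator_mem v₀
  have e2 : (2 : ℤ) = ((2 : ℕ) : ℤ) := by norm_num
  revert x
  rw [e2]
  intro x hxS hx0 hx hloc
  refine exists_selmer_dying_twist_of_selmer_dying_strict_natCast W hsurj hΔ hK hH h2K hd hWd hxS hx0 hx hℓv₀ ?_
  subst hv₀
  exact localization_eq_zero_of_mem_strictLocalKer W v₀ hloc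

/-- ★★★ **`𝒩(Wd) ⟺ SteerAt`: the twin's bit IS LINE 38's steering clause.**  `W/ℚ` globally minimal, `Δ_W < 0`, `ρ̄_{W,2}` onto (no level-`4`
hypothesis); `K` imaginary quadratic with odd `d_K = −ℓ₀`, Heegner, `2` split; `Wd` any elliptic model of `W^{(d_K)}`.  THEN: **no non-zero class of
`Sel₂(Wd)` dies on `Γ_{ℚ(Wd[4])}` IFF every non-zero class of `Sel₂(W)` dying on `Γ_{ℚ(E[4])}` is ALIVE at `ℓ₀`** (`∉ ker (H¹(ℚ,E[2]) →
H¹(ℚ_{ℓ₀},E[2]))`) — the right side is LINE 38's `SteerAt W ℓ₀` (pen bsd-idea-1 g28, `Cruxes/GenusDeepSupplyAtTwoNegDiscNarrow/Lines/steered_supply.lean`)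
with its body verbatim, the left side LINE 37's `TwinNonPhantomBit Wd` at level `(2 : ℤ)`.  Both transports; no trace bit, no uniqueness.
[cite: MazurRubin2010, Def. 3.1, Lemma 2.10–2.11, Prop. 3.3] [cite: LawsonWuthrich2016, §3] -/
theorem forall_selmer_twist_eq_zero_iff_steerAt
    (hsurj : W.HasSurjectiveModNGaloisRep 2)
    (hΔ : W.Δ < 0) (hK : IsImaginaryQuadratic K) (hodd : Odd (discr K))
    (hH : SatisfiesHeegnerHypothesis (W.conductorNorm ℤ) K) (h2K : ((Ideal.span {(2 : ℤ)}).primesOver (𝓞 K)).ncard = 2)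
    {ℓ : ℕ} [Fact ℓ.Prime] (hd : discr K = -(ℓ : ℤ)) {Wd : WeierstrassCurve ℚ} [Wd.IsElliptic] {C : VariableChange ℚ}
    (hWd : C • W.quadraticTwist (discr K : ℚ) = Wd) :
    (∀ c ∈ Wd.selmerGroup 2, (∀ h ∈ torsionFixing Wd (4 : ℤ), h1Eval Wd (2 : ℤ) c h = 0) → c = 0) ↔
      ∀ y : galH1Torsion W (2 : ℤ), y ∈ W.selmerGroup 2 → y ≠ 0 →
        (∀ h ∈ torsionFixing W (4 : ℤ), h1Eval W (2 : ℤ) y h = 0) → y ∉ W.torsionLocalKer ℚ_[ℓ] (2 : ℤ) := by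
  constructor
  · intro hN y hyS hy0 hydies hyloc
    obtain ⟨c, hcS, hc0, hcdies⟩ :=
      exists_selmer_dying_twist_of_selmer_dying_mem_torsionLocalKer W hsurj hΔ hK hH h2K hd hWd hyS hy0 hydies hyloc
    exact hc0 (hN c hcS hcdies)
  · intro hS c hcS hcdies
    by_contra hc0
    obtain ⟨y, hyS, hy0, hydies, hyloc⟩ :=
      exists_selmer_dying_mem_torsionLocalKer_of_selmer_dying_twist W hsurj hΔ hK hodd hH h2K hd hWd hcS hc0 hcdies
    exact hS y hyS hy0 hydies hyloc

/-- ★★★ **`𝒫 = (β)`: `¬𝒩(Wd) ⟺ 4 ∣ a_{ℓ₀}(W)` ON THE SELMER-ENTANGLED CELL, AT EVERY PRIME HEEGNER FRAME.**  `W/ℚ` globally minimal, `Δ_W < 0`,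
`ρ̄_{W,2}` and `ρ_{W,4}` onto; `K` imaginary quadratic with odd `d_K = −ℓ₀` (`ℓ₀` prime), Heegner, `2` split; `Wd` any elliptic model of
`W^{(d_K)}`; `x ∈ Sel₂(W)` non-zero dying on `Γ_{ℚ(E[4])}`.  THEN **some non-zero class of `Sel₂(Wd)` dies on `Γ_{ℚ(Wd[4])}` iff
`4 ∣ a_{ℓ₀}(W)`** — T (§4) composed with the trace bit at an arbitrary prime Heegner frame (g34
`TraceBit.mem_torsionLocalKer_padic_iff_four_dvd_of_prime_frame`: every Frobenius above `ℓ₀` is a transposition on `E[2]`, and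
`loc_{ℓ₀} x = 0 ⟺ 4 ∣ a_{ℓ₀}`).  So the pen's `𝒫`-half of the phantom cell is EXACTLY the (β)-half «bit FALSE ∧ `4 ∣ a_{ℓ₀}`»; the
instrument column «`𝒫/𝒩` tag ⟺ LOCXI0 ⟺ `a_{ℓ₀} mod 4`» of LINE 37/38 is a theorem. [cite: LawsonWuthrich2016, §3, §7.1]
[cite: MazurRubin2010, Def. 3.1, Lemma 2.10–2.11, Prop. 3.3] [cite: GrossLMS1991, §9 Prop. 9.6] [cite: SilvermanAEC2009, Thm. V.2.3.1] -/
theorem exists_selmer_dying_twist_iff_four_dvd_frobeniusTrace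
    (hsurj : W.HasSurjectiveModNGaloisRep 2) (hsurj4 : W.HasSurjectiveModNGaloisRep 4)
    (hΔ : W.Δ < 0) (hK : IsImaginaryQuadratic K) (hodd : Odd (discr K))
    (hH : SatisfiesHeegnerHypothesis (W.conductorNorm ℤ) K) (h2K : ((Ideal.span {(2 : ℤ)}).primesOver (𝓞 K)).ncard = 2)
    {ℓ : ℕ} [Fact ℓ.Prime] (hd : discr K = -(ℓ : ℤ)) {Wd : WeierstrassCurve ℚ} [Wd.IsElliptic] {C : VariableChange ℚ}
    (hWd : C • W.quadraticTwist (discr K : ℚ) = Wd)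
    {x : galH1Torsion W (2 : ℤ)} (hxS : x ∈ W.selmerGroup 2) (hx0 : x ≠ 0)
    (hx : ∀ h ∈ torsionFixing W (4 : ℤ), h1Eval W (2 : ℤ) x h = 0) :
    (∃ c ∈ Wd.selmerGroup 2, c ≠ 0 ∧ ∀ h ∈ torsionFixing Wd (4 : ℤ), h1Eval Wd (2 : ℤ) c h = 0) ↔
      (4 : ℤ) ∣ W.frobeniusTrace ℓ := by
  obtain ⟨v, 𝔓, γ, hv, -, h𝔓, hγ⟩ := exists_isArithFrobAt_placeOver ℓ
  have hℓv : (ℓ : 𝓞 ℚ) ∈ v.asIdeal := by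
    rw [← hv]
    exact Rat.HeightOneSpectrum.natCast_natGenerator_mem v
  rw [exists_selmer_dying_twist_iff_mem_torsionLocalKer W hsurj hsurj4 hΔ hK hodd hH h2K hd hWd hxS hx0 hx]
  exact TraceBit.mem_torsionLocalKer_padic_iff_four_dvd_of_prime_frame W hsurj hsurj4 hΔ hx0 hx hK hodd hH hd hℓv h𝔓 hγ

/-- **(α) ⟹ `𝒩(Wd)`** on the Selmer-entangled cell: if `a_{ℓ₀}(W) ≢ 0 (mod 4)` then NO non-zero class of `Sel₂(Wd)` dies on `Γ_{ℚ(Wd[4])}` — the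
twin's generator is not the phantom, at every (α)-frame. [cite: LawsonWuthrich2016, §3, §7.1] [cite: MazurRubin2010, Prop. 3.3] -/
theorem forall_selmer_twist_eq_zero_of_not_four_dvd
    (hsurj : W.HasSurjectiveModNGaloisRep 2) (hsurj4 : W.HasSurjectiveModNGaloisRep 4)
    (hΔ : W.Δ < 0) (hK : IsImaginaryQuadratic K) (hodd : Odd (discr K))
    (hH : SatisfiesHeegnerHypothesis (W.conductorNorm ℤ) K) (h2K : ((Ideal.span {(2 : ℤ)}).primesOver (𝓞 K)).ncard = 2)
    {ℓ : ℕ} [Fact ℓ.Prime] (hd : discr K = -(ℓ : ℤ)) {Wd : WeierstrassCurve ℚ} [Wd.IsElliptic] {C : VariableChange ℚ}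
    (hWd : C • W.quadraticTwist (discr K : ℚ) = Wd)
    {x : galH1Torsion W (2 : ℤ)} (hxS : x ∈ W.selmerGroup 2) (hx0 : x ≠ 0)
    (hx : ∀ h ∈ torsionFixing W (4 : ℤ), h1Eval W (2 : ℤ) x h = 0) (h4 : ¬ (4 : ℤ) ∣ W.frobeniusTrace ℓ) :
    ∀ c ∈ Wd.selmerGroup 2, (∀ h ∈ torsionFixing Wd (4 : ℤ), h1Eval Wd (2 : ℤ) c h = 0) → c = 0 := by
  intro c hcS hcdies
  by_contra hc0
  exact h4 ((exists_selmer_dying_twist_iff_four_dvd_frobeniusTrace W hsurj hsurj4 hΔ hK hodd hH h2K hd hWd hxS hx0 hx).mp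
    ⟨c, hcS, hc0, hcdies⟩)

/-- **A SELMER-DISENTANGLED CURVE HAS `𝒩(Wd)` AT EVERY PRIME HEEGNER FRAME** (the «bit TRUE» half): if every non-zero class of `Sel₂(W)`
survives on `Γ_{ℚ(E[4])}` (`ξ_W ∉ Sel₂(W)`), then no non-zero class of `Sel₂(Wd)` dies on `Γ_{ℚ(Wd[4])}`, whatever `a_{ℓ₀}` — the class-level
companion of g10's `exists_torsionFixing_four_smul_ne_of_selmer_disentangled` (points), read in the twin's own tower.
[cite: MazurRubin2010, Def. 3.1, Lemma 2.11, Prop. 3.3] [cite: LawsonWuthrich2016, §3] -/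
theorem forall_selmer_twist_eq_zero_of_selmer_disentangled
    (hsurj : W.HasSurjectiveModNGaloisRep 2)
    (hΔ : W.Δ < 0) (hK : IsImaginaryQuadratic K) (hodd : Odd (discr K))
    (hH : SatisfiesHeegnerHypothesis (W.conductorNorm ℤ) K) (h2K : ((Ideal.span {(2 : ℤ)}).primesOver (𝓞 K)).ncard = 2)
    {ℓ : ℕ} [Fact ℓ.Prime] (hd : discr K = -(ℓ : ℤ)) {Wd : WeierstrassCurve ℚ} [Wd.IsElliptic] {C : VariableChange ℚ}
    (hWd : C • W.quadraticTwist (discr K : ℚ) = Wd)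
    (hdis : ∀ y ∈ W.selmerGroup 2, y ≠ 0 → ∃ h ∈ torsionFixing W (4 : ℤ), h1Eval W (2 : ℤ) y h ≠ 0) :
    ∀ c ∈ Wd.selmerGroup 2, (∀ h ∈ torsionFixing Wd (4 : ℤ), h1Eval Wd (2 : ℤ) c h = 0) → c = 0 := by
  intro c hcS hcdies
  by_contra hc0
  obtain ⟨y, hyS, hy0, hydies, -⟩ :=
    exists_selmer_dying_mem_torsionLocalKer_of_selmer_dying_twist W hsurj hΔ hK hodd hH h2K hd hWd hcS hc0 hcdies
  obtain ⟨h, hh, hne⟩ := hdis y hyS hy0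
  exact hne (hydies h hh)

/-- ★★★ **THE STEERING BINDER IS THE TWIN'S BIT: `𝒩(Wd) ⟺ («ξ_W ∈ Sel₂(W)» ⟹ `4 ∤ a_{ℓ₀}(W)`)`.**  `W/ℚ` globally minimal, `Δ_W < 0`, `ρ̄_{W,2}` and
`ρ_{W,4}` onto; `K` imaginary quadratic with odd `d_K = −ℓ₀` (`ℓ₀` prime), Heegner, `2` split; `Wd` any elliptic model of `W^{(d_K)}`.  THEN:
**no non-zero class of `Sel₂(Wd)` dies on `Γ_{ℚ(Wd[4])}` IFF every non-zero class of `Sel₂(W)` dying on `Γ_{ℚ(E[4])}` has `4 ∤ a_{ℓ₀}(W)`** —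
i.e. the pen's `TwinNonPhantomBit Wd` (LINE 37) is EXACTLY the director's (677) steering binder «`4 ∤ a_{ℓ₀}(E)` when `ξ_E ∈ Sel₂(E)`» of
`K4NegSteered` / LINE 38 `SteerAt`; `𝒩 = (α) ∪ {bit TRUE}`, `𝒫 = (β)`.  (⟹) §5 ★★★; (⟸) the transport §5 + the trace bit.
[cite: LawsonWuthrich2016, §3, §7.1] [cite: MazurRubin2010, Def. 3.1, Lemma 2.10–2.11, Prop. 3.3] [cite: GrossLMS1991, §9 Prop. 9.6] -/
theorem forall_selmer_twist_eq_zero_iff_selmer_dying_imp_not_four_dvd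
    (hsurj : W.HasSurjectiveModNGaloisRep 2) (hsurj4 : W.HasSurjectiveModNGaloisRep 4)
    (hΔ : W.Δ < 0) (hK : IsImaginaryQuadratic K) (hodd : Odd (discr K))
    (hH : SatisfiesHeegnerHypothesis (W.conductorNorm ℤ) K) (h2K : ((Ideal.span {(2 : ℤ)}).primesOver (𝓞 K)).ncard = 2)
    {ℓ : ℕ} [Fact ℓ.Prime] (hd : discr K = -(ℓ : ℤ)) {Wd : WeierstrassCurve ℚ} [Wd.IsElliptic] {C : VariableChange ℚ}
    (hWd : C • W.quadraticTwist (discr K : ℚ) = Wd) :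
    (∀ c ∈ Wd.selmerGroup 2, (∀ h ∈ torsionFixing Wd (4 : ℤ), h1Eval Wd (2 : ℤ) c h = 0) → c = 0) ↔
      ∀ y ∈ W.selmerGroup 2, y ≠ 0 → (∀ h ∈ torsionFixing W (4 : ℤ), h1Eval W (2 : ℤ) y h = 0) →
        ¬ (4 : ℤ) ∣ W.frobeniusTrace ℓ := by
  constructor
  · intro hN y hyS hy0 hydies h4
    obtain ⟨c, hcS, hc0, hcdies⟩ :=
      (exists_selmer_dying_twist_iff_four_dvd_frobeniusTrace W hsurj hsurj4 hΔ hK hodd hH h2K hd hWd hyS hy0 hydies).mpr h4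
    exact hc0 (hN c hcS hcdies)
  · intro hB c hcS hcdies
    by_contra hc0
    obtain ⟨y, hyS, hy0, hydies, hyloc⟩ :=
      exists_selmer_dying_mem_torsionLocalKer_of_selmer_dying_twist W hsurj hΔ hK hodd hH h2K hd hWd hcS hc0 hcdies
    obtain ⟨v, 𝔓, γ, hv, -, h𝔓, hγ⟩ := exists_isArithFrobAt_placeOver ℓ
    have hℓv : (ℓ : 𝓞 ℚ) ∈ v.asIdeal := by
      rw [← hv]
      exact Rat.HeightOneSpectrum.natCast_natGenerator_mem v
    exact hB y hyS hy0 hydies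
      ((TraceBit.mem_torsionLocalKer_padic_iff_four_dvd_of_prime_frame W hsurj hsurj4 hΔ hy0 hydies hK hodd hH hd hℓv h𝔓 hγ).mp hyloc)

end TraceDictionary

end Summit.BirchSwinnertonDyer.BirchSwinnertonDyer.Theorems.GenusExact.PhantomDescentBit.TwinLevelFour

end
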